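import Literature.Analysis.FluidPDE.StokesTorusProofs
import HarnessLib

/-!
# The Stokes operator on `T^d` commutes with its Galerkin projections (proof)

`Literature.Analysis.FluidPDE.StokesTorus` vendors, as the named fact
`Torus.stokesOperator_galerkinProj`, the commutation relation `A (P_N v) = P_N (A v)` for
`v ∈ D(A)` between the Stokes operator `A = Torus.stokesOperator d` of the flat torus (the graph
operator `v ↦ -Δ v` on the energy space `H`, domain `D(A) = H ∩ H²`) and the Galerkin projections
`P_N = Torus.galerkinProj N`, the orthogonal projections of `L²(T^d; ℝ^d)` onto
`Torus.galerkinSpace N = span {a cos(2πk·x), a sin(2πk·x) : k ∈ galerkinIndex N, a = projPerp k i}`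
(Constantin–Foias 1988, Ch. 4, (4.41)–(4.42) with Remark 4.13: in the periodic case `A = -Δ` on
`D(A)`, with eigenvalues `4π²|k|²/L²` and eigenfunctions `c w_k + c̄ w_{-k}`, `c ⊥ k`; Ch. 7,
(7.4): `P_m f = ∑_{j ≤ m} (w_j, f) w_j`; Ch. 8, the display preceding (8.3): applying `P_m` to the
equation gives `d/dt P_m u + A (P_m u) + … = P_m f`, i.e. `P_m A = A P_m` on `D(A)`). This file
**proves** it (`Torus.stokesOperator_galerkinProj_holds`), together with the auxiliary fact of the
same file that the argument passes through, `Torus.galerkinProj_mem_domain_stokesOperator`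
(`P_N v ∈ D(A)`; `Torus.galerkinProj_mem_domain_stokesOperator_holds`). It sits on top of
`StokesTorusProofs`, which shows that the Stokes modes are smooth solenoidal mean-zero fields in
`H` satisfying the weak Stokes relation `(W, λ_k W) ∈ stokesGraph d`
(`Torus.isStokesImage_stokesModeL2`, `Torus.laplacian_stokesMode`).

## Proof

* By `StokesTorusProofs`, each Galerkin generator `W = stokesModeL2 k (projPerp k i) c`
  (`k ∈ galerkinIndex N`, so `k ≠ 0`, and `projPerp k i ⊥ k`) satisfies
  `(W, λ_k W) ∈ stokesGraph d`, `λ_k = 4π²|k|²`, i.e. is an eigenvector of `A`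
  (Constantin–Foias (4.42)); by linearity over the span, `A` maps `galerkinSpace N` into itself,
  in particular `galerkinSpace N ≤ D(A)` (Constantin–Foias, Ch. 7, proof of Thm. 7.3: "`P_m H` is
  the span of `{w_1, …, w_m}` and thus is contained in `D(A^α)`").
* Conversely, testing the weak relation `w = -Δ v` of any `(v, w) ∈ stokesGraph d` against the
  admissible test field `g = stokesMode k a c` (`Δ g = -λ_k g`) gives `⟪w, W⟫ = λ_k ⟪v, W⟫`
  (`IsStokesImage.inner_stokesModeL2`).
* Hence for `v ∈ D(A)` and every generator `W` of `galerkinSpace N` (with `P_N = P_N*`,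
  `P_N W = W`): `⟪A (P_N v), W⟫ = λ_k ⟪P_N v, W⟫ = λ_k ⟪v, W⟫ = ⟪A v, W⟫ = ⟪P_N (A v), W⟫`. Both
  `A (P_N v)` and `P_N (A v)` lie in the finite-dimensional `galerkinSpace N`, so they coincide.

## Mathlib / tree search

Mathlib (this pin): `LinearPMap.mem_graph`, `LinearPMap.mem_graph_snd_inj`,
`LinearPMap.mem_domain_iff`, `Submodule.inner_starProjection_left_eq_right`,
`Submodule.starProjection_eq_self_iff`, `Submodule.mem_orthogonal'`; no Stokes operator or
Galerkin spaces (grep `Stokes`, `Galerkin`: only `Literature/`). The tree's `StokesTorusProofs`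
supplies the mode calculus (`isSmooth_stokesMode`, `isDivFree_stokesMode`, `hasZeroMean_stokesMode`,
`laplacian_stokesMode`, `stokesModeL2_mem_energySpace`, `isStokesImage_stokesModeL2`), reused here.

## References

* P. Constantin, C. Foias, *Navier–Stokes Equations*, Chicago Lectures in Mathematics, Univ. of
  Chicago Press (1988), Ch. 4: (4.36), (4.41)–(4.42), Remark 4.13; Ch. 7: (7.4), proof of
  Thm. 7.3; Ch. 8: (8.3) and the display preceding it. [ConstantinFoias1988]
* R. Temam, *Navier–Stokes Equations. Theory and Numerical Analysis*, North-Holland (1977),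
  Ch. I §2.6 (eigenfunctions of the Stokes operator, space-periodic case), Ch. III §3 (Galerkin
  method).
-/

noncomputable section

open MeasureTheory Filter UnitAddTorus
open scoped InnerProductSpace RealInnerProductSpace ENNReal

namespace Literature.Analysis.FluidPDE

namespace Torus

variable {d : Type*} [Fintype d] [DecidableEq d]

/-! ## Testing the weak Stokes relation against a mode -/

/-- **Testing the weak Stokes relation against a mode**: if `w = -Δ v` weakly
(`IsStokesImage v w`) and `W = stokesModeL2 k a c` with `k ≠ 0`, `a ⊥ k` (an admissible test
field: smooth, divergence free, mean zero, with `Δ W = -λ_k W`), then `⟪w, W⟫ = λ_k ⟪v, W⟫`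
(Constantin–Foias 1988, Ch. 4, (4.36)–(4.37): `(A u)_k = 4π²|k|² u_k`). [folklore] -/
theorem IsStokesImage.inner_stokesModeL2
    {v w : Lp (EuclideanSpace ℝ d) 2 (volume : Measure (UnitAddTorus d))}
    (h : IsStokesImage v w) {k : d → ℤ} {a : EuclideanSpace ℝ d} (hk : k ≠ 0)
    (hka : ⟪FunctionSpaces.Torus.latticeVec k, a⟫_ℝ = 0) (c : Bool) :
    ⟪w, stokesModeL2 k a c⟫_ℝ = stokesEigenvalue k * ⟪v, stokesModeL2 k a c⟫_ℝ := by
  have hg := isSmooth_stokesMode k a c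
  have hΔ : MemLp (fun x => FunctionSpaces.Torus.laplacian
      (stokesMode k a c : UnitAddTorus d → EuclideanSpace ℝ d) x) 2
      (volume : Measure (UnitAddTorus d)) :=
    hg.laplacian.memLp 2
  have key := h (stokesModeL2 k a c) (hΔ.toLp _) (stokesMode k a c) hg (isDivFree_stokesMode hka c)
    (hasZeroMean_stokesMode hk a c) (coeFn_stokesModeL2 k a c) (MemLp.coeFn_toLp hΔ)
  have hψ : hΔ.toLp _ = (-stokesEigenvalue k) • stokesModeL2 k a c := by
    refine Lp.ext ?_
    filter_upwards [MemLp.coeFn_toLp hΔ, Lp.coeFn_smul (-stokesEigenvalue k) (stokesModeL2 k a c),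
      coeFn_stokesModeL2 k a c] with x h₁ h₂ h₃
    rw [h₁, h₂, Pi.smul_apply, h₃, laplacian_stokesMode]
  rw [key, hψ, real_inner_smul_right, neg_mul, neg_neg]

/-! ## The Galerkin spaces are invariant under the Stokes operator -/

/-- The Galerkin generators are eigenvectors of the Stokes operator, graph form:
`(W, λ_k W) ∈ stokesGraph d` for `W = stokesModeL2 k a c`, `k ≠ 0`, `a ⊥ k`
(Constantin–Foias 1988, (4.42); `Torus.isStokesImage_stokesModeL2`). [folklore] -/
theorem stokesModeL2_mem_stokesGraph {k : d → ℤ} {a : EuclideanSpace ℝ d} (hk : k ≠ 0)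
    (hka : ⟪FunctionSpaces.Torus.latticeVec k, a⟫_ℝ = 0) (c : Bool) :
    (stokesModeL2 k a c, stokesEigenvalue k • stokesModeL2 k a c) ∈ stokesGraph d :=
  ⟨stokesModeL2_mem_energySpace hk hka c,
    Submodule.smul_mem _ _ (stokesModeL2_mem_energySpace hk hka c),
    isStokesImage_stokesModeL2 k a c⟩

/-- Each member of the Galerkin family is an eigenvector of `A` (graph form). [folklore] -/
theorem galerkinFamily_mem_stokesGraph (N : ℕ) (p : ↥(galerkinIndex (d := d) N) × d × Bool) :
    (galerkinFamily N p, stokesEigenvalue (p.1 : d → ℤ) • galerkinFamily N p) ∈ stokesGraph d := by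
  obtain ⟨⟨k, hk⟩, i, c⟩ := p
  have hk0 : k ≠ 0 := (mem_galerkinIndex_iff'.mp hk).2
  exact stokesModeL2_mem_stokesGraph hk0 (inner_latticeVec_projPerp hk0 i) c

/-- `A` maps the Galerkin space into itself, graph form: every `u ∈ galerkinSpace N` has a
partner `u' ∈ galerkinSpace N` with `(u, u') ∈ stokesGraph d` (linearity over the
generators). [folklore] -/
theorem exists_mem_stokesGraph_of_mem_galerkinSpace {N : ℕ}
    {u : Lp (EuclideanSpace ℝ d) 2 (volume : Measure (UnitAddTorus d))}
    (hu : u ∈ galerkinSpace (d := d) N) :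
    ∃ u' ∈ galerkinSpace (d := d) N, (u, u') ∈ stokesGraph d := by
  change u ∈ Submodule.span ℝ _ at hu
  induction hu using Submodule.span_induction with
  | mem u hu =>
    obtain ⟨p, rfl⟩ := hu
    exact ⟨_, Submodule.smul_mem _ _ (Submodule.subset_span ⟨p, rfl⟩),
      galerkinFamily_mem_stokesGraph N p⟩
  | zero => exact ⟨0, zero_mem _, zero_mem _⟩
  | add u w _ _ hu hw =>
    obtain ⟨u', hu', hgu⟩ := hu
    obtain ⟨w', hw', hgw⟩ := hw
    exact ⟨u' + w', add_mem hu' hw', add_mem hgu hgw⟩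
  | smul r u _ hu =>
    obtain ⟨u', hu', hgu⟩ := hu
    exact ⟨r • u', Submodule.smul_mem _ r hu', Submodule.smul_mem _ r hgu⟩

/-- The Galerkin spaces lie in the domain of the Stokes operator: `galerkinSpace N ≤ D(A)`
(Constantin–Foias 1988, Ch. 7, proof of Thm. 7.3: `P_m H = span {w_1, …, w_m} ⊂ D(A)`). [folklore] -/
theorem galerkinSpace_le_domain_stokesOperator (N : ℕ) :
    galerkinSpace (d := d) N ≤ (stokesOperator d).domain := by
  intro u hu
  obtain ⟨u', -, h⟩ := exists_mem_stokesGraph_of_mem_galerkinSpace hu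
  rw [LinearPMap.mem_domain_iff, graph_stokesOperator]
  exact ⟨u', h⟩

/-- The Stokes operator maps each Galerkin space into itself: `A u ∈ galerkinSpace N` for
`u ∈ galerkinSpace N` (Constantin–Foias 1988, Ch. 8, (8.3): `A u_m ∈ P_m H`). [folklore] -/
theorem stokesOperator_apply_mem_galerkinSpace {N : ℕ} (u : (stokesOperator d).domain)
    (hu : (u : Lp (EuclideanSpace ℝ d) 2 (volume : Measure (UnitAddTorus d))) ∈
      galerkinSpace (d := d) N) :
    stokesOperator d u ∈ galerkinSpace (d := d) N := by
  obtain ⟨u', hu', h⟩ := exists_mem_stokesGraph_of_mem_galerkinSpace hu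
  rw [← graph_stokesOperator] at h
  have hAu : stokesOperator d u = u' :=
    (stokesOperator d).mem_graph_snd_inj ((stokesOperator d).mem_graph u) h rfl
  rw [hAu]
  exact hu'

/-- Discharge of the named fact `Torus.galerkinProj_mem_domain_stokesOperator`: `P_N v ∈ D(A)`
for every `v ∈ L²` (Constantin–Foias 1988, Ch. 7, proof of Thm. 7.3: "`P_m H` is the span of
`{w_1, …, w_m}` and thus is contained in `D(A^α)` for all `α > 0`").
[cite: ConstantinFoias1988, Ch. 7 proof of Thm. 7.3 before (7.10)] -/
theorem galerkinProj_mem_domain_stokesOperator_holds :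
    galerkinProj_mem_domain_stokesOperator (d := d) :=
  fun N v => galerkinSpace_le_domain_stokesOperator N (galerkinProj_apply_mem N v)

/-! ## Commutation with the Galerkin projections -/

/-- `P_N` is symmetric and fixes `galerkinSpace N`: `⟪P_N z, W⟫ = ⟪z, W⟫` for
`W ∈ galerkinSpace N`. [folklore] -/
theorem inner_galerkinProj_left_of_mem {N : ℕ}
    (z : Lp (EuclideanSpace ℝ d) 2 (volume : Measure (UnitAddTorus d)))
    {W : Lp (EuclideanSpace ℝ d) 2 (volume : Measure (UnitAddTorus d))}
    (hW : W ∈ galerkinSpace (d := d) N) : ⟪galerkinProj N z, W⟫_ℝ = ⟪z, W⟫_ℝ := by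
  rw [galerkinProj, Submodule.inner_starProjection_left_eq_right,
    Submodule.starProjection_eq_self_iff.mpr hW]

/-- An element of `galerkinSpace N` orthogonal to every Galerkin generator vanishes. [folklore] -/
theorem eq_zero_of_mem_galerkinSpace_of_inner_galerkinFamily {N : ℕ}
    {z : Lp (EuclideanSpace ℝ d) 2 (volume : Measure (UnitAddTorus d))}
    (hz : z ∈ galerkinSpace (d := d) N) (h : ∀ p, ⟪z, galerkinFamily N p⟫_ℝ = 0) : z = 0 := by
  have hperp : z ∈ (galerkinSpace (d := d) N)ᗮ := by
    rw [Submodule.mem_orthogonal']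
    intro u hu
    change u ∈ Submodule.span ℝ _ at hu
    induction hu using Submodule.span_induction with
    | mem u hu =>
      obtain ⟨p, rfl⟩ := hu
      exact h p
    | zero => exact inner_zero_right _
    | add u w _ _ hu hw => rw [inner_add_right, hu, hw, add_zero]
    | smul r u _ hu => rw [real_inner_smul_right, hu, mul_zero]
  exact inner_self_eq_zero.mp (Submodule.inner_right_of_mem_orthogonal hz hperp)

/-- Discharge of the named fact `Torus.stokesOperator_galerkinProj`: **the Galerkin projections
commute with the Stokes operator**, `A (P_N v) = P_N (A v)` for `v ∈ D(A)` (Constantin–Foias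
1988, Ch. 4, (4.42) and Remark 4.13; Ch. 8, the display preceding (8.3); Temam 1977, Ch. III
§3). Both sides lie in `galerkinSpace N` and have the same inner product `λ_k ⟪v, W⟫` with every
generator `W`. [cite: ConstantinFoias1988, Ch. 8 display preceding (8.3)] -/
theorem stokesOperator_galerkinProj_holds : stokesOperator_galerkinProj (d := d) := by
  intro hmem N v
  have hx : stokesOperator d ⟨galerkinProj N ↑v, hmem N _⟩ ∈ galerkinSpace (d := d) N :=
    stokesOperator_apply_mem_galerkinSpace _ (galerkinProj_apply_mem N _)
  have hy : galerkinProj N (stokesOperator d v) ∈ galerkinSpace (d := d) N :=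
    galerkinProj_apply_mem N _
  refine sub_eq_zero.mp
    (eq_zero_of_mem_galerkinSpace_of_inner_galerkinFamily (Submodule.sub_mem _ hx hy) ?_)
  rintro ⟨⟨k, hk⟩, i, c⟩
  have hk0 : k ≠ 0 := (mem_galerkinIndex_iff'.mp hk).2
  have hka : ⟪FunctionSpaces.Torus.latticeVec k, projPerp k i⟫_ℝ = 0 :=
    inner_latticeVec_projPerp hk0 i
  have hW : stokesModeL2 k (projPerp k i) c ∈ galerkinSpace (d := d) N :=
    Submodule.subset_span ⟨(⟨k, hk⟩, i, c), rfl⟩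
  have hv : IsStokesImage ↑v (stokesOperator d v) := by
    have h := (stokesOperator d).mem_graph v
    rw [graph_stokesOperator] at h
    exact h.2.2
  have hPv : IsStokesImage (galerkinProj N ↑v) (stokesOperator d ⟨galerkinProj N ↑v, hmem N _⟩) := by
    have h := (stokesOperator d).mem_graph ⟨galerkinProj N ↑v, hmem N _⟩
    rw [graph_stokesOperator] at h
    exact h.2.2
  show ⟪_ - _, stokesModeL2 k (projPerp k i) c⟫_ℝ = 0
  rw [inner_sub_left, hPv.inner_stokesModeL2 hk0 hka c, inner_galerkinProj_left_of_mem _ hW,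
    inner_galerkinProj_left_of_mem _ hW, hv.inner_stokesModeL2 hk0 hka c, sub_self]

end Torus

end Literature.Analysis.FluidPDE
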